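import Summits.QuantumAdvantage.QuantumAdvantage.Theorems.NearExactIsExact.Negative.SmallCases

/-!
# Crux `CubicForrelation.NearExactIsExact` (stmt-QuantumAdvantage-14043) — the syndrome layer of the exact
  two-sided census at `n = 6` (`θ₆ = 25/32`), part 1/4

Certificate seat `b2b-cforr-cert` (gen 10).  HONEST FRAMING: infrastructure for a DECIDABLE VERDICT about the finite
slice `n = 6` of the crux — NOT summit progress.

The census (parts 2–4) decides, for every cubic `g : 𝔽₂⁶ → 𝔽₂`, the exact value `max_f Σ_x (−1)^{f(x)} W_g(x)` over
cubic partners `f` by a SYNDROME test: `f` is cubic iff it is orthogonal to `RM(2,6) = RM(3,6)^⊥`, i.e. iff the XOR of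
the COLUMNS `col(x) = (m(x))_{deg m ≤ 2} ∈ 𝔽₂^{22}` over `supp f` vanishes.  Here: the degree-`≤ 2` monomials
(`sy_mons2`), the columns (`sy_col`), the syndrome of a predicate on codes (`sy_synd`) with its linearity
(`sy_synd_bxor`) and filter form (`sy_synd_eq_xorCols`), and the vanishing of the syndrome of every cubic function on
`n ≥ 6` bits (`sy_synd_cubic`: a cubic times a monomial of degree `≤ 2` has degree `≤ 5 < n`, hence even weight by
McEliece's theorem `stub_axParity`).  Only the direction "cubic ⇒ syndrome 0" is needed downstream.

References: F. J. MacWilliams, N. J. A. Sloane, *The Theory of Error-Correcting Codes* (1977) Ch. 13 §3–§4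
(`RM(r,m)^⊥ = RM(m−r−1,m)`); C. Carlet, *Boolean Functions for Cryptography and Coding Theory* (CUP 2021) §4.1
(McEliece's divisibility theorem).  Everything below is proved from the tree; axioms are the standard three.
-/

set_option linter.dupNamespace false -- D-0017: single-problem summit ⇒ `QuantumAdvantage.QuantumAdvantage` by design

namespace Summit.QuantumAdvantage.QuantumAdvantage.Theorems.CubicForrelation.NearExactIsExact

open Finset
open Literature.Computability.QuantumComplexity
open Summit.QuantumAdvantage.QuantumAdvantage.Theorems.SignedExactSliceIsLift (litVal monoVal)
open Summit.QuantumAdvantage.QuantumAdvantage.Theorems.SignedExactSliceIsLift.StubMoebius (isDegLeFun_and isDegLeFun_all)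
open Summit.QuantumAdvantage.QuantumAdvantage.Theorems.NearExactIsExact.Negative.SmallCases
  (singles pairs pt maskOf maskOf_lt mem_pairs mem_singles sum_pt)

/-! ### Degree-`≤ 2` monomials and columns -/

/-- The monomials of degree `≤ 2` on `n` variables, as increasing index lists: `∅`, the singletons, the pairs.
[cite: MacWilliamsSloane1977, Ch. 13 §3] -/
def sy_mons2 (n : ℕ) : List (List ℕ) := [[]] ++ singles n ++ pairs n

/-- A member of `sy_mons2 n` has at most two indices. [folklore] -/
theorem sy_take_length_le_two {n : ℕ} {S : List ℕ} (h : S ∈ sy_mons2 n) : (S.take 3).length ≤ 2 := by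
  simp only [sy_mons2, List.singleton_append, List.mem_cons, List.mem_append] at h
  rcases h with (rfl | h) | h
  · simp
  · obtain ⟨i, -, rfl⟩ := mem_singles h; simp
  · obtain ⟨i, j, -, -, rfl⟩ := mem_pairs h; simp

/-- A monomial of `sy_mons2 n` is a function of degree `≤ 2`. [cite: Carlet2020, §2.2.1 Def. 6] -/
theorem sy_isDegLeFun_monoVal {n : ℕ} {S : List ℕ} (h : S ∈ sy_mons2 n) :
    IsDegLeFun 2 (fun x : Fin n → Bool => monoVal n S x) :=
  (isDegLeFun_all (S.take 3)).mono (sy_take_length_le_two h)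

/-- The COLUMN of the code `k`: bit `j` is the value at `pt n k` of the `j`-th monomial of degree `≤ 2`.
[cite: MacWilliamsSloane1977, Ch. 13 §3] -/
def sy_col (n k : ℕ) : ℕ := maskOf (fun S => monoVal n S (pt n k)) (sy_mons2 n)

/-- Bits of the mask of a predicate: bit `j` is `P L[j]` (and `false` beyond the length). [folklore] -/
theorem sy_testBit_maskOf (P : List ℕ → Bool) : ∀ (L : List (List ℕ)) (j : ℕ),
    (maskOf P L).testBit j = ((L[j]?).map P).getD false
  | [], j => by simp [maskOf]
  | S :: L, 0 => by
    rw [maskOf, Nat.testBit_zero]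
    cases hP : P S <;> simp [Nat.add_mod, hP]
  | S :: L, j + 1 => by
    rw [maskOf, Nat.testBit_add_one]
    have hb : (P S).toNat ≤ 1 := Bool.toNat_le _
    have e : ((P S).toNat + 2 * maskOf P L) / 2 = maskOf P L := by omega
    rw [e, sy_testBit_maskOf P L j]
    simp

/-- Bits of a column: the monomial values (and `false` beyond the number of monomials). [folklore] -/
theorem sy_testBit_col (n k j : ℕ) :
    (sy_col n k).testBit j = (((sy_mons2 n)[j]?).map fun S => monoVal n S (pt n k)).getD false :=
  sy_testBit_maskOf _ _ _

/-! ### Syndromes of predicates on codes -/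

/-- The SYNDROME of a predicate `h` over a list of codes, for a column function `col`: the XOR of the columns of the
selected codes. [cite: MacWilliamsSloane1977, Ch. 13 §4] -/
def sy_synd (col : ℕ → ℕ) (h : ℕ → Bool) : List ℕ → ℕ
  | [] => 0
  | k :: ks => (if h k then col k else 0) ^^^ sy_synd col h ks

/-- The XOR of the columns of a list of codes. [folklore] -/
def sy_xorCols (col : ℕ → ℕ) : List ℕ → ℕ
  | [] => 0
  | k :: ks => col k ^^^ sy_xorCols col ks

/-- The syndrome is the column-XOR over the selected sublist. [folklore] -/
theorem sy_synd_eq_xorCols (col : ℕ → ℕ) (h : ℕ → Bool) : ∀ L : List ℕ,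
    sy_synd col h L = sy_xorCols col (L.filter h)
  | [] => rfl
  | k :: ks => by
    rw [sy_synd, List.filter_cons, sy_synd_eq_xorCols col h ks]
    cases h k <;> simp [sy_xorCols]

/-- Column-XOR is additive over concatenation. [folklore] -/
theorem sy_xorCols_append (col : ℕ → ℕ) : ∀ L L' : List ℕ,
    sy_xorCols col (L ++ L') = sy_xorCols col L ^^^ sy_xorCols col L'
  | [], L' => by simp [sy_xorCols]
  | k :: ks, L' => by
    rw [List.cons_append, sy_xorCols, sy_xorCols, sy_xorCols_append col ks L', Nat.xor_assoc]

/-- **Linearity of the syndrome**: the syndrome of a pointwise XOR is the XOR of the syndromes. [folklore] -/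
theorem sy_synd_bxor (col : ℕ → ℕ) (a b : ℕ → Bool) : ∀ L : List ℕ,
    sy_synd col (fun k => xor (a k) (b k)) L = sy_synd col a L ^^^ sy_synd col b L
  | [] => by simp [sy_synd]
  | k :: ks => by
    rw [sy_synd, sy_synd, sy_synd, sy_synd_bxor col a b ks]
    have hx : ∀ u v w : ℕ, (u ^^^ v) ^^^ w = u ^^^ (v ^^^ w) := fun u v w => Nat.xor_assoc u v w
    cases a k <;> cases b k <;> simp [hx, Nat.xor_left_comm]

/-- The syndrome only reads the predicate on the listed codes. [folklore] -/
theorem sy_synd_congr (col : ℕ → ℕ) {a b : ℕ → Bool} : ∀ L : List ℕ, (∀ k ∈ L, a k = b k) →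
    sy_synd col a L = sy_synd col b L
  | [], _ => rfl
  | k :: ks, h => by
    rw [sy_synd, sy_synd, h k List.mem_cons_self, sy_synd_congr col ks fun j hj => h j (List.mem_cons_of_mem _ hj)]

/-- The syndrome only reads the columns of the listed codes. [folklore] -/
theorem sy_synd_congr_col {col col' : ℕ → ℕ} (a : ℕ → Bool) : ∀ L : List ℕ, (∀ k ∈ L, col k = col' k) →
    sy_synd col a L = sy_synd col' a L
  | [], _ => rfl
  | k :: ks, h => by
    rw [sy_synd, sy_synd, h k List.mem_cons_self, sy_synd_congr_col a ks fun j hj => h j (List.mem_cons_of_mem _ hj)]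

/-! ### Parity folds and bits of a syndrome -/

/-- XOR-fold (parity) of a predicate over a list. [folklore] -/
def sy_par (p : ℕ → Bool) : List ℕ → Bool
  | [] => false
  | k :: ks => xor (p k) (sy_par p ks)

/-- Bit `j` of a syndrome is the parity of the selected codes whose column has bit `j`. [folklore] -/
theorem sy_testBit_synd (col : ℕ → ℕ) (h : ℕ → Bool) (j : ℕ) : ∀ L : List ℕ,
    (sy_synd col h L).testBit j = sy_par (fun k => h k && (col k).testBit j) L
  | [] => by simp [sy_synd, sy_par]
  | k :: ks => by
    rw [sy_synd, sy_par, Nat.testBit_xor, sy_testBit_synd col h j ks]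
    cases h k <;> simp

/-- The parity fold is the parity of the number of selected elements. [folklore] -/
theorem sy_par_eq (p : ℕ → Bool) : ∀ L : List ℕ, sy_par p L = decide ((L.filter p).length % 2 = 1)
  | [] => by simp [sy_par]
  | k :: ks => by
    rw [sy_par, sy_par_eq p ks, List.filter_cons]
    cases p k
    · simp
    · simp only [if_true, List.length_cons, Bool.true_xor]
      by_cases h : (List.filter p ks).length % 2 = 1
      · simp [h]; omega
      · simp [h]; omega

/-- The parity fold only reads the predicate on the listed elements. [folklore] -/
theorem sy_par_congr {p q : ℕ → Bool} : ∀ L : List ℕ, (∀ k ∈ L, p k = q k) → sy_par p L = sy_par q L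
  | [], _ => rfl
  | k :: ks, h => by
    rw [sy_par, sy_par, h k List.mem_cons_self, sy_par_congr ks fun j hj => h j (List.mem_cons_of_mem _ hj)]

/-- Length of a filtered range as a sum of indicators. [folklore] -/
theorem sy_length_filter_range (p : ℕ → Bool) : ∀ N : ℕ,
    ((List.range N).filter p).length = ∑ k ∈ range N, (if p k then 1 else 0)
  | 0 => by simp
  | N + 1 => by
    rw [List.range_succ, List.filter_append, List.length_append, sy_length_filter_range p N, sum_range_succ]
    cases hp : p N <;> simp [hp]

/-! ### Cubic functions have syndrome zero -/

/-- `Σ_x (−1)^{Q(x)} + 2·#{Q = 1} = 2^n`. [folklore] -/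
theorem sy_sum_signOf_add_card {n : ℕ} (Q : (Fin n → Bool) → Bool) :
    ∑ x, signOf (Q x) + 2 * ((univ.filter fun x => Q x = true).card : ℝ) = (2 : ℝ) ^ n := by
  have e : ∀ x, signOf (Q x) = 1 - 2 * (if Q x = true then (1 : ℝ) else 0) := fun x => by
    cases Q x <;> norm_num [signOf]
  simp_rw [e]
  rw [sum_sub_distrib, ← mul_sum, sum_boole, sum_const, card_univ, Fintype.card_fun, Fintype.card_bool,
    Fintype.card_fin, nsmul_eq_mul, mul_one]
  push_cast
  ring

/-- **Even weights.** For `n ≥ 6`, a cubic `f` and a degree-`≤ 2` function `m` on `n` bits, `#{x : f(x) ∧ m(x)}` is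
even: `f·m` has degree `≤ 5 < n` (McEliece / Ax, `stub_axParity`). [cite: Carlet2020, §4.1] -/
theorem sy_even_card_and {n : ℕ} (hn : 6 ≤ n) (f m : (Fin n → Bool) → Bool) (hf : IsDegLeFun 3 f)
    (hm : IsDegLeFun 2 m) : Even ((univ.filter fun x => (f x && m x) = true).card) := by
  have hdeg : IsDegLeFun 5 (fun x => (f x && m x)) := isDegLeFun_and hf hm
  obtain ⟨z, hz⟩ := stub_axParity n 5 (fun x => (f x && m x)) univ (by norm_num) hdeg
  have huniv : (univ.filter fun u : Fin n → Bool => ∀ i, u i = true → i ∈ (univ : Finset (Fin n))) = univ := by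
    ext u; simp
  rw [huniv, card_univ, Fintype.card_fin] at hz
  have hsc := sy_sum_signOf_add_card (fun x => (f x && m x))
  set c := (univ.filter fun x => (f x && m x) = true).card with hc
  have he : 2 ≤ (n + 5 - 1) / 5 := by omega
  obtain ⟨e, he'⟩ : ∃ e, (n + 5 - 1) / 5 = e + 2 := ⟨(n + 5 - 1) / 5 - 2, by omega⟩
  obtain ⟨n', hn'⟩ : ∃ n', n = n' + 2 := ⟨n - 2, by omega⟩
  rw [he'] at hz
  have hzint : ((2 : ℤ) ^ n : ℤ) - 2 * (c : ℤ) = 2 ^ (e + 2) * z := by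
    have h' : ((2 : ℝ) ^ n) - 2 * (c : ℝ) = (2 : ℝ) ^ (e + 2) * (z : ℝ) := by rw [← hz]; linarith
    exact_mod_cast h'
  rw [hn'] at hzint
  have h4n : (2 : ℤ) ^ (n' + 2) = 4 * 2 ^ n' := by ring
  have h4e : (2 : ℤ) ^ (e + 2) = 4 * 2 ^ e := by ring
  rw [h4n, h4e] at hzint
  have hc' : (c : ℤ) = 2 * (2 ^ n' - 2 ^ e * z) := by linarith
  have : Even (c : ℤ) := ⟨2 ^ n' - 2 ^ e * z, by rw [hc']; ring⟩
  exact (Int.even_coe_nat c).1 this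

/-- **The syndrome of a cubic function vanishes** (`n ≥ 6`, any column function agreeing with `sy_col n` on the
codes `< 2^n`): `f ∈ RM(3,n) ⊆ RM(2,n)^⊥`. [cite: MacWilliamsSloane1977, Ch. 13 §4] -/
theorem sy_synd_cubic {n : ℕ} (hn : 6 ≤ n) (col : ℕ → ℕ) (hcol : ∀ k, k < 2 ^ n → col k = sy_col n k)
    (f : (Fin n → Bool) → Bool) (hf : IsDegLeFun 3 f) :
    sy_synd col (fun k => f (pt n k)) (List.range (2 ^ n)) = 0 := by
  apply Nat.eq_of_testBit_eq
  intro j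
  rw [Nat.zero_testBit, sy_testBit_synd]
  rw [sy_par_congr (q := fun k => f (pt n k) && (sy_col n k).testBit j) (List.range (2 ^ n))
    (fun k hk => by rw [hcol k (List.mem_range.1 hk)])]
  rw [sy_par_eq, sy_length_filter_range]
  by_cases hj : j < (sy_mons2 n).length
  · set S := (sy_mons2 n)[j] with hS
    have hSmem : S ∈ sy_mons2 n := List.getElem_mem hj
    have e : ∀ k, (f (pt n k) && (sy_col n k).testBit j) = (f (pt n k) && monoVal n S (pt n k)) := by
      intro k; rw [sy_testBit_col, List.getElem?_eq_getElem hj]; rfl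
    simp_rw [e]
    rw [← sum_pt n (fun x => if (f x && monoVal n S x) = true then 1 else 0), sum_boole]
    obtain ⟨r, hr⟩ := sy_even_card_and hn f (fun x => monoVal n S x) hf (sy_isDegLeFun_monoVal hSmem)
    simp only [Nat.cast_id, decide_eq_false_iff_not]
    omega
  · have e : ∀ k, (f (pt n k) && (sy_col n k).testBit j) = false := by
      intro k
      rw [sy_testBit_col, List.getElem?_eq_none (by omega)]
      simp
    simp_rw [e]
    simp

end Summit.QuantumAdvantage.QuantumAdvantage.Theorems.CubicForrelation.NearExactIsExact
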